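import Literature.MathematicalPhysics.QuantumFieldTheory.Balaban1983to89.B1Eq324BenfattoKernelComparisonBounded
import Literature.MathematicalPhysics.QuantumFieldTheory.Balaban1983to89.B1Eq324BenfattoKernelCondField
import HarnessLib

/-!
# `Balaban1983to89.B1Eq324BenfattoKernelSect5Eq513` — [BenfattoEtAl1978] §5 p. 155, (5.13) «the integral factorizes over the boxes», FOR THE CLASS of
# [Balaban1985BackgroundPropagators] Sect. E p. 428, IN THE §5 CONSUMER'S CURRENCY: real observables of the configuration reading a part and the
# corridors, integrated against the PART FIELDS of the sub-precisions — two-sided, PROVED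

statement-level skeleton of published theorems with citation tags; proofs where landed; nothing here is a claim about the
Yang–Mills mass gap

WHY THIS MODULE (cell `pub-ymgap`, seat `dag-n08-d` gen 13, INTENT-53 file (A); node N08 [Balaban1985UV3]; the [BenfattoEtAl1978] source chain behind
the (α)-row `h324`).  `…KernelComparisonBounded` (J5-T) proves the temperature-zero substitute for print's exact (5.13): under the conditioned class
field `P̄^K_{Γ,ξ}`, an `ℝ≥0∞`-valued observable of the `Λ ∖ Γ`-coordinates supported in a bounded-fluctuation region integrates within `e^{±(ρ+T/2)}` of
its integral against the product of the plain Dirichlet box Gaussians, stated in the MATRIX currency (`multivariateGaussian` on `EuclideanSpace ℝ ↥(box p)`).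
Every §5 consumer ((5.15)'s product over the boxes, the per-box estimates (5.16)–(5.33), the cluster side of n08-c's port map) reads instead REAL bounded
observables of the WHOLE configuration — a box weight `e^{Ψ_□(z)}` reads `z` on `□ = shrink ∪ Γ₁(□)`, i.e. on the part AND on the corridors — integrated
against MEASURES ON CONFIGURATIONS.  This file is that translation, once: the per-part comparison measure is presented as the PART FIELD
`N^K_{P,ξ} := 𝒩(0,K_P)∘(u_Γ(ξ)+·)⁻¹`, where `K_P` is the class kernel of the sub-precision `A|_P` passed as a ROW `hK_P : K_P x y = [x,y∈P]·((A|_P)⁻¹)_{xy}`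
(`…KernelOfPrecision`'s `hK` at `(Λ, A) := (P, A|_P)`, so every class theorem F2–F10 there applies to the part field by instantiation); under `N^K_{P,ξ}` the
configuration IS the centre `u_Γ(ξ)` off `P` — in particular `ξ` on `Γ` — almost surely, exactly as under `P̄^K_{Γ,ξ}` on `Γ` (`…KernelCondField.condFieldK_ae_eqOn`),
so both sides of the comparison may be written with the SAME observable of the whole configuration.  The bounded-fluctuation hypothesis is displayed
per site (`G_p(z) ≠ 0 → r_y(z_y − u_Γ(ξ)_y)² ≤ t_y` on `box p`, `Σ_y t_y ≤ T`) — the form in which §5's cut-offs deliver it (file (B) `…KernelSect5Eq515`).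

WHAT IS PROVED (standard axioms; no `sorry`; no definition).
* §0 plumbing for Gaussian fields of a kernel on `Q₀`: `measurable_shift`, `eval_ae_eq_zero_of_kernel_self_eq_zero` (`K x x = 0 ⇒ z_x = 0` a.s.),
  `ae_forall_eval_eq_zero`, `shift_ae_eqOn` (under `𝒩(0,K)∘(u+·)⁻¹` the field equals `u` a.s. wherever the kernel's diagonal vanishes), `measurable_condMean`,
  `measurable_shift₂`, `stronglyMeasurable_integral_shift` (`ξ ↦ ∫ G d[Q∘(u_C(ξ)+·)⁻¹]` is measurable — Fubini measurability after the change of variables).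
* §1 for the class kernel `hK`: `ae_eq_zero_of_not_mem` / `condFieldK_ae_eq_zero_of_not_mem` (the class field and the conditioned class field vanish off `Λ`
  a.s.), `partField_ae_eqOn` (under `N^K_{P,ξ}`, `P ⊆ Λ ∖ Γ`: `z_c = ξ_c` on `Γ` a.s.), `partField_ae_eq_condMean_of_not_mem` (`z_x = u_Γ(ξ)_x` off `P` a.s.); and
  ★★ `exp_mul_prod_integral_part_le_integral_prod_condFieldK` / `integral_prod_condFieldK_le_exp_mul_prod_integral_part` — THE CLASS (5.13) IN THE CONSUMER'S
  CURRENCY: for a partition `π` of `↥(Λ ∖ Γ)` into parts `box p` with cross-row sums `Σ_{π y′ ≠ π y}|A_{yy′}| ≤ r_y ≤ r_max < γ`, measurable REAL observables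
  `0 ≤ G_p ≤ M_p` reading only `box p ∪ Γ`, and the per-site budget above,
  `e^{−(ρ+T/2)}·Π_p ∫ G_p dN^K_{box p,ξ} ≤ ∫ Π_p G_p dP̄^K_{Γ,ξ} ≤ e^{ρ+T/2}·Π_p ∫ G_p dN^K_{box p,ξ}`, `ρ = Σ_y r_y/(γ − r_max)` (J5-T §3 at
  `F_p := ofReal ∘ G_p ∘ (glue ξ off box p)`; the window law of the part fields `…KernelComparison.lintegral_comp_restrict_shift_eq` +
  `…KernelComparisonBoxes.covGram_kernel_eq_inv`; `ofReal_integral_eq_lintegral_ofReal` both ways).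
HONEST SCOPE.  Transport and assembly over seat n08-b's matrix estimates, this seat's J1–J5-T and the tree's Kolmogorov field; the class, the substitute for
(5.13) and the bounded-fluctuation device are OURS (a reading of [Balaban1985BackgroundPropagators] p. 428 for [Balaban1982Higgs1] p. 616), not print; nothing
of [Balaban1985UV3] / [Balaban1985UV2] is asserted; no generalised Basic Lemma is stated; the §5-side port is not commissioned and nothing of it is chained
here; count-neutral for N08; nothing about d = 4, the continuum, OS axioms, a mass gap or the Clay problem.
-/
noncomputable section

open MeasureTheory ProbabilityTheory Finset Matrix WithLp
open scoped BigOperators Matrix NNReal ENNReal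

namespace Literature.MathematicalPhysics.QuantumFieldTheory.Balaban1983to89.B1Eq324BenfattoKernelSect5Eq513

open Literature.MathematicalPhysics.QuantumFieldTheory
open Literature.MathematicalPhysics.QuantumFieldTheory.GaussianToolkit
open Literature.MathematicalPhysics.QuantumFieldTheory.Balaban1983to89.B1Eq324BenfattoLemma
open Literature.MathematicalPhysics.QuantumFieldTheory.Balaban1983to89.B1Eq324BenfattoKernelRegression
open Literature.MathematicalPhysics.QuantumFieldTheory.Balaban1983to89.B1Eq324BenfattoKernelOfPrecision
open Literature.MathematicalPhysics.QuantumFieldTheory.Balaban1983to89.B1Eq324BenfattoKernelCondField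
open Literature.MathematicalPhysics.QuantumFieldTheory.Balaban1983to89.B1Eq324BenfattoKernelComparison
open Literature.MathematicalPhysics.QuantumFieldTheory.Balaban1983to89.B1Eq324BenfattoKernelComparisonBoxes
open Literature.MathematicalPhysics.QuantumFieldTheory.Balaban1983to89.B1Eq324BenfattoKernelComparisonBounded
open Literature.MathematicalPhysics.QuantumFieldTheory.Balaban1983to89.B1Eq324BenfattoClassAppendixC (posDef_of_coercive)
open Literature.MathematicalPhysics.QuantumFieldTheory.Balaban1983to89.B1Eq324BenfattoCondCentre (condMean_apply_of_mem)

variable {d : ℕ}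

/-! ## §0  Plumbing: almost-sure values of a Gaussian field where the kernel's diagonal vanishes; measurability of parametrised integrals -/

section Plumbing

variable {K : B1Eq324BenfattoLemma.Site d → B1Eq324BenfattoLemma.Site d → ℝ}

/-- kernel: the shift `ζ ↦ u + ζ` by a fixed configuration is measurable. [folklore]
[cite: BenfattoEtAl1978, Appendix C 2) p.164 «a non centered gaussian field … and center u» (class form)] -/
theorem measurable_shift (u : B1Eq324BenfattoLemma.Site d → ℝ) :
    Measurable fun (ζ : B1Eq324BenfattoLemma.Site d → ℝ) (x : B1Eq324BenfattoLemma.Site d) => u x + ζ x :=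
  measurable_pi_lambda _ fun x => measurable_const.add (measurable_pi_apply x)

/-- **A coordinate of variance zero vanishes almost surely**: if `K x x = 0` then `z_x = 0`, `𝒩(0,K)`-a.s. (its law is `N(0,0) = δ₀`).
[folklore] [cite: BenfattoEtAl1978, Appendix C (C.6)–(C.7) p.164 (class form)] -/
theorem eval_ae_eq_zero_of_kernel_self_eq_zero (hK : IsPosSemidefKernel K) {x : B1Eq324BenfattoLemma.Site d} (hx : K x x = 0) :
    ∀ᵐ ζ ∂gaussianFieldOfKernel K, ζ x = 0 := by
  set Q := gaussianFieldOfKernel K with hQ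
  haveI : IsProbabilityMeasure Q := isProbabilityMeasure_gaussianFieldOfKernel hK
  have hX : HasGaussianLaw (fun ζ : B1Eq324BenfattoLemma.Site d → ℝ => ζ x) Q :=
    (isGaussianProcess_eval_gaussianFieldOfKernel hK).hasGaussianLaw_eval x
  have hmap := hX.map_eq_gaussianReal
  have hmean : ∫ ζ, ζ x ∂Q = 0 := integral_eval_gaussianFieldOfKernel hK x
  have hvar : Var[fun ζ : B1Eq324BenfattoLemma.Site d → ℝ => ζ x; Q] = 0 := by
    rw [← covariance_self (measurable_pi_apply x).aemeasurable, covariance_eval_gaussianFieldOfKernel hK x x]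
    exact hx
  rw [hmean, hvar, Real.toNNReal_zero, gaussianReal_zero_var] at hmap
  have hzero : Q {ζ | ζ x ≠ 0} = 0 := by
    have hset : {ζ : B1Eq324BenfattoLemma.Site d → ℝ | ζ x ≠ 0} = (fun ζ : B1Eq324BenfattoLemma.Site d → ℝ => ζ x) ⁻¹' {0}ᶜ := rfl
    rw [hset, ← Measure.map_apply (measurable_pi_apply x) (MeasurableSet.singleton 0).compl, hmap,
      Measure.dirac_apply' _ (MeasurableSet.singleton 0).compl]
    simp
  rw [ae_iff]
  simpa using hzero

/-- **The field vanishes a.s. on any set of sites where the kernel's diagonal vanishes** (countably many coordinates). [folklore]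
[cite: BenfattoEtAl1978, Appendix C (C.6)–(C.7) p.164 (class form)] -/
theorem ae_forall_eval_eq_zero (hK : IsPosSemidefKernel K) {S : Set (B1Eq324BenfattoLemma.Site d)} (hS : ∀ x ∈ S, K x x = 0) :
    ∀ᵐ ζ ∂gaussianFieldOfKernel K, ∀ x ∈ S, ζ x = 0 :=
  (ae_ball_iff (Set.to_countable S)).2 fun x hx => eval_ae_eq_zero_of_kernel_self_eq_zero hK (hS x hx)

/-- **Under the shifted field `𝒩(0,K)∘(u+·)⁻¹` the configuration EQUALS `u` a.s. on any set of sites where the kernel's diagonal vanishes.**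
[folklore] [cite: BenfattoEtAl1978, Appendix C 2) p.164 «a non centered gaussian field … and center u» (class form)] -/
theorem shift_ae_eqOn (hK : IsPosSemidefKernel K) (u : B1Eq324BenfattoLemma.Site d → ℝ) {S : Set (B1Eq324BenfattoLemma.Site d)}
    (hS : ∀ x ∈ S, K x x = 0) :
    ∀ᵐ z ∂((gaussianFieldOfKernel K).map
        fun (ζ : B1Eq324BenfattoLemma.Site d → ℝ) (x : B1Eq324BenfattoLemma.Site d) => u x + ζ x),
      ∀ x ∈ S, z x = u x := by
  rw [ae_map_iff (measurable_shift u).aemeasurable]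
  · filter_upwards [ae_forall_eval_eq_zero hK hS] with ζ hζ x hx
    rw [hζ x hx, add_zero]
  · have hset : {z : B1Eq324BenfattoLemma.Site d → ℝ | ∀ x ∈ S, z x = u x} =
        ⋂ x ∈ S, {z : B1Eq324BenfattoLemma.Site d → ℝ | z x = u x} := by
      ext z
      simp only [Set.mem_setOf_eq, Set.mem_iInter]
    rw [hset]
    exact MeasurableSet.biInter (Set.to_countable S) fun x _ =>
      measurableSet_eq_fun (measurable_pi_apply (X := fun _ : B1Eq324BenfattoLemma.Site d => ℝ) x) measurable_const

/-- The regression centre `ξ ↦ u_C(ξ)(x)` is a measurable (indeed linear) function of the datum. [folklore]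
[cite: BenfattoEtAl1978, Appendix C (C.7) p.164] -/
theorem measurable_condMean (K : B1Eq324BenfattoLemma.Site d → B1Eq324BenfattoLemma.Site d → ℝ) (C : Finset (B1Eq324BenfattoLemma.Site d))
    (x : B1Eq324BenfattoLemma.Site d) : Measurable fun ξ : B1Eq324BenfattoLemma.Site d → ℝ => condMean K C ξ x := by
  simp only [condMean]
  exact Finset.measurable_sum _ fun c _ => Finset.measurable_sum _ fun c' _ => measurable_const.mul (measurable_pi_apply _)

/-- The two-argument shift `(ξ, ζ) ↦ u_C(ξ) + ζ` is jointly measurable. [folklore] [cite: BenfattoEtAl1978, Appendix C (C.7) p.164] -/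
theorem measurable_shift₂ (K : B1Eq324BenfattoLemma.Site d → B1Eq324BenfattoLemma.Site d → ℝ) (C : Finset (B1Eq324BenfattoLemma.Site d)) :
    Measurable fun (p : (B1Eq324BenfattoLemma.Site d → ℝ) × (B1Eq324BenfattoLemma.Site d → ℝ)) (x : B1Eq324BenfattoLemma.Site d) =>
      condMean K C p.1 x + p.2 x :=
  measurable_pi_lambda _ fun x => ((measurable_condMean K C x).comp measurable_fst).add ((measurable_pi_apply x).comp measurable_snd)

/-- **A box integral is a measurable function of the datum**: for a measurable real observable `G` and an s-finite measure `Q` on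
configurations, `ξ ↦ ∫ G d[Q∘(u_C(ξ)+·)⁻¹]` is (strongly) measurable (change of variables + Fubini measurability). [folklore]
[cite: BenfattoEtAl1978, §5 (5.13) p.155 (class form)] -/
theorem stronglyMeasurable_integral_shift (K : B1Eq324BenfattoLemma.Site d → B1Eq324BenfattoLemma.Site d → ℝ)
    (C : Finset (B1Eq324BenfattoLemma.Site d)) (Q : Measure (B1Eq324BenfattoLemma.Site d → ℝ)) [SFinite Q]
    {G : (B1Eq324BenfattoLemma.Site d → ℝ) → ℝ} (hG : Measurable G) :
    StronglyMeasurable fun ξ : B1Eq324BenfattoLemma.Site d → ℝ =>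
      ∫ z, G z ∂(Q.map fun (ζ : B1Eq324BenfattoLemma.Site d → ℝ) (x : B1Eq324BenfattoLemma.Site d) => condMean K C ξ x + ζ x) := by
  have heq : (fun ξ : B1Eq324BenfattoLemma.Site d → ℝ =>
      ∫ z, G z ∂(Q.map fun (ζ : B1Eq324BenfattoLemma.Site d → ℝ) (x : B1Eq324BenfattoLemma.Site d) => condMean K C ξ x + ζ x)) =
      fun ξ => ∫ ζ, G (fun x => condMean K C ξ x + ζ x) ∂Q := by
    funext ξ
    exact integral_map (measurable_shift _).aemeasurable hG.aestronglyMeasurable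
  rw [heq]
  exact (hG.comp (measurable_shift₂ K C)).stronglyMeasurable.integral_prod_right'

end Plumbing

/-! ## §1  The class kernel: a.s. values off `Λ`, the part fields, and (5.13) in the consumer's currency -/

section Core

variable {Λ : Finset (B1Eq324BenfattoLemma.Site d)} {A : Matrix Λ Λ ℝ}
  {K : B1Eq324BenfattoLemma.Site d → B1Eq324BenfattoLemma.Site d → ℝ}
  (hK : ∀ x y, K x y = if h : x ∈ Λ ∧ y ∈ Λ then (A⁻¹ : Matrix Λ Λ ℝ) ⟨x, h.1⟩ ⟨y, h.2⟩ else 0)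

include hK

/-- **The class field vanishes off `Λ`, almost surely** (`K x x = 0` for `x ∉ Λ`). [cite: BenfattoEtAl1978, §1 p.144 (class form)] -/
theorem ae_eq_zero_of_not_mem (hA : A.PosDef) :
    ∀ᵐ z ∂gaussianFieldOfKernel K, ∀ x, x ∉ Λ → z x = 0 := by
  have h := ae_forall_eval_eq_zero (isPosSemidefKernel_kernel hK hA) (S := (↑Λ : Set (B1Eq324BenfattoLemma.Site d))ᶜ)
    fun x hx => kernel_eq_zero_of_not_mem_left hK (fun hxΛ => hx (Finset.mem_coe.mpr hxΛ)) x
  filter_upwards [h] with z hz x hx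
  exact hz x fun hxΛ => hx (Finset.mem_coe.mp hxΛ)

/-- **The conditioned class field `P̄^K_{Γ,ξ}` vanishes off `Λ`, almost surely** (its centre and its Dirichlet covariance vanish there:
`…KernelOfPrecision.condMean_kernel_eq_zero_of_not_mem`, `condCov_kernel_eq_zero_of_not_mem`).
[cite: BenfattoEtAl1978, Appendix C 2) (C.6)–(C.7) p.164 (class form)] -/
theorem condFieldK_ae_eq_zero_of_not_mem (hA : A.PosDef) {Γ : Finset (B1Eq324BenfattoLemma.Site d)} (hΓ : Γ ⊆ Λ)
    (ξ : B1Eq324BenfattoLemma.Site d → ℝ) :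
    ∀ᵐ z ∂((gaussianFieldOfKernel (condCov K Γ)).map
        fun (ζ : B1Eq324BenfattoLemma.Site d → ℝ) (x : B1Eq324BenfattoLemma.Site d) => condMean K Γ ξ x + ζ x),
      ∀ x, x ∉ Λ → z x = 0 := by
  have hKc : IsPosSemidefKernel (condCov K Γ) :=
    isPosSemidefKernel_condCov K (isPosSemidefKernel_kernel hK hA) Γ (isUnit_det_covGram_kernel hK hA hΓ)
  have h := shift_ae_eqOn hKc (condMean K Γ ξ) (S := (↑Λ : Set (B1Eq324BenfattoLemma.Site d))ᶜ)
    fun x hx => condCov_kernel_eq_zero_of_not_mem hK Γ (Or.inl fun hxΛ => hx (Finset.mem_coe.mpr hxΛ))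
  filter_upwards [h] with z hz x hx
  rw [hz x fun hxΛ => hx (Finset.mem_coe.mp hxΛ)]
  exact condMean_kernel_eq_zero_of_not_mem hK Γ ξ hx

/-- **Under a part field `N^K_{P,ξ}` the `Γ`-values are the datum's, almost surely** (`P ⊆ Λ ∖ Γ`: the part kernel vanishes on `Γ` and the
centre reproduces `ξ` there). [cite: BenfattoEtAl1978, p.152 «P̂₀(dz|(z̄_Δ)_{Δ∈C})»; Appendix C (C.7) p.164 (class form)] -/
theorem partField_ae_eqOn (hA : A.PosDef) {Γ : Finset (B1Eq324BenfattoLemma.Site d)} (hΓ : Γ ⊆ Λ)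
    {P : Finset (B1Eq324BenfattoLemma.Site d)} (hP : P ⊆ Λ \ Γ) {KP : B1Eq324BenfattoLemma.Site d → B1Eq324BenfattoLemma.Site d → ℝ}
    (hKP : ∀ x y, KP x y = if h : x ∈ P ∧ y ∈ P then
      ((A.submatrix (fun j : ↥P => (⟨j, (Finset.mem_sdiff.mp (hP j.2)).1⟩ : Λ))
        (fun j : ↥P => (⟨j, (Finset.mem_sdiff.mp (hP j.2)).1⟩ : Λ)))⁻¹ : Matrix ↥P ↥P ℝ) ⟨x, h.1⟩ ⟨y, h.2⟩ else 0)
    (ξ : B1Eq324BenfattoLemma.Site d → ℝ) :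
    ∀ᵐ z ∂((gaussianFieldOfKernel KP).map
        fun (ζ : B1Eq324BenfattoLemma.Site d → ℝ) (x : B1Eq324BenfattoLemma.Site d) => condMean K Γ ξ x + ζ x),
      ∀ c ∈ Γ, z c = ξ c := by
  have hPD : (A.submatrix (fun j : ↥P => (⟨j, (Finset.mem_sdiff.mp (hP j.2)).1⟩ : Λ))
      (fun j : ↥P => (⟨j, (Finset.mem_sdiff.mp (hP j.2)).1⟩ : Λ))).PosDef :=
    hA.submatrix fun a b hab => Subtype.ext (by simpa using congrArg Subtype.val hab)
  have hKPpsd : IsPosSemidefKernel KP := isPosSemidefKernel_kernel hKP hPD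
  have hS : ∀ x ∈ (Γ : Set (B1Eq324BenfattoLemma.Site d)), KP x x = 0 := fun x hx => by
    have hxP : x ∉ P := fun hxP => (Finset.mem_sdiff.mp (hP hxP)).2 (Finset.mem_coe.mp hx)
    rw [hKP, dif_neg fun h => hxP h.1]
  filter_upwards [shift_ae_eqOn hKPpsd (condMean K Γ ξ) hS] with z hz c hc
  rw [hz c (Finset.mem_coe.mpr hc)]
  exact condMean_apply_of_mem K Γ ξ (isUnit_det_covGram_kernel hK hA hΓ) hc

omit hK in
/-- **Under a part field `N^K_{P,ξ}` the configuration equals the centre `u_Γ(ξ)` off `P`, almost surely**; in particular it vanishes off `Λ`.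
[cite: BenfattoEtAl1978, Appendix C 2) p.164 «center u» (class form)] -/
theorem partField_ae_eq_condMean_of_not_mem (hA : A.PosDef) {Γ : Finset (B1Eq324BenfattoLemma.Site d)}
    {P : Finset (B1Eq324BenfattoLemma.Site d)} (hP : P ⊆ Λ \ Γ) {KP : B1Eq324BenfattoLemma.Site d → B1Eq324BenfattoLemma.Site d → ℝ}
    (hKP : ∀ x y, KP x y = if h : x ∈ P ∧ y ∈ P then
      ((A.submatrix (fun j : ↥P => (⟨j, (Finset.mem_sdiff.mp (hP j.2)).1⟩ : Λ))
        (fun j : ↥P => (⟨j, (Finset.mem_sdiff.mp (hP j.2)).1⟩ : Λ)))⁻¹ : Matrix ↥P ↥P ℝ) ⟨x, h.1⟩ ⟨y, h.2⟩ else 0)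
    (ξ : B1Eq324BenfattoLemma.Site d → ℝ) :
    ∀ᵐ z ∂((gaussianFieldOfKernel KP).map
        fun (ζ : B1Eq324BenfattoLemma.Site d → ℝ) (x : B1Eq324BenfattoLemma.Site d) => condMean K Γ ξ x + ζ x),
      ∀ x, x ∉ P → z x = condMean K Γ ξ x := by
  have hPD : (A.submatrix (fun j : ↥P => (⟨j, (Finset.mem_sdiff.mp (hP j.2)).1⟩ : Λ))
      (fun j : ↥P => (⟨j, (Finset.mem_sdiff.mp (hP j.2)).1⟩ : Λ))).PosDef :=
    hA.submatrix fun a b hab => Subtype.ext (by simpa using congrArg Subtype.val hab)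
  have hKPpsd : IsPosSemidefKernel KP := isPosSemidefKernel_kernel hKP hPD
  have hS : ∀ x ∈ ((↑P : Set (B1Eq324BenfattoLemma.Site d))ᶜ), KP x x = 0 := fun x hx => by
    rw [hKP, dif_neg fun h => hx (Finset.mem_coe.mpr h.1)]
  filter_upwards [shift_ae_eqOn hKPpsd (condMean K Γ ξ) hS] with z hz x hx
  exact hz x fun hxP => hx (Finset.mem_coe.mp hxP)

/-- kernel: the two-sided class (5.13) in the consumer's currency (both directions share every intermediate object).
[cite: BenfattoEtAl1978, §5 (5.13) p.155 (class substitute at temperature zero; ours)] -/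
private theorem core_two_sided {σ : Type*} [Fintype σ] [DecidableEq σ]
    (hAs : ∀ e e', A e e' = A e' e) {γ rmax : ℝ} (hγ0 : 0 < γ)
    (hγ : ∀ x : Λ → ℝ, γ * ∑ e, x e ^ 2 ≤ ∑ e, ∑ e', A e e' * x e * x e')
    {Γ : Finset (B1Eq324BenfattoLemma.Site d)} (hΓ : Γ ⊆ Λ) (π : ↥(Λ \ Γ) → σ) (r : ↥(Λ \ Γ) → ℝ)
    (hr : ∀ y : ↥(Λ \ Γ), ∑ y' : ↥(Λ \ Γ), (if π y = π y' then (0 : ℝ) else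
      |A ⟨y, (Finset.mem_sdiff.mp y.2).1⟩ ⟨y', (Finset.mem_sdiff.mp y'.2).1⟩|) ≤ r y)
    (hrmax : ∀ y, r y ≤ rmax) (hγr : rmax < γ) (ξ : B1Eq324BenfattoLemma.Site d → ℝ)
    (box : σ → Finset (B1Eq324BenfattoLemma.Site d)) (hboxsub : ∀ p, box p ⊆ Λ \ Γ)
    (hbox : ∀ p (y : ↥(Λ \ Γ)), (y : B1Eq324BenfattoLemma.Site d) ∈ box p ↔ π y = p)
    {Kb : σ → B1Eq324BenfattoLemma.Site d → B1Eq324BenfattoLemma.Site d → ℝ}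
    (hKb : ∀ p x y, Kb p x y = if h : x ∈ box p ∧ y ∈ box p then
      ((A.submatrix (fun j : ↥(box p) => (⟨j, (Finset.mem_sdiff.mp (hboxsub p j.2)).1⟩ : Λ))
        (fun j : ↥(box p) => (⟨j, (Finset.mem_sdiff.mp (hboxsub p j.2)).1⟩ : Λ)))⁻¹ : Matrix ↥(box p) ↥(box p) ℝ)
          ⟨x, h.1⟩ ⟨y, h.2⟩ else 0)
    {G : σ → (B1Eq324BenfattoLemma.Site d → ℝ) → ℝ} (hGm : ∀ p, Measurable (G p)) (hG0 : ∀ p z, 0 ≤ G p z) {M : σ → ℝ}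
    (hGM : ∀ p z, G p z ≤ M p)
    (hGdep : ∀ p (z z' : B1Eq324BenfattoLemma.Site d → ℝ), (∀ x, x ∈ box p ∨ x ∈ Γ → z x = z' x) → G p z = G p z')
    {t : ↥(Λ \ Γ) → ℝ} {T : ℝ}
    (hGt : ∀ p (z : B1Eq324BenfattoLemma.Site d → ℝ), G p z ≠ 0 → ∀ y : ↥(Λ \ Γ), (y : B1Eq324BenfattoLemma.Site d) ∈ box p →
      r y * (z y - condMean K Γ ξ y) ^ 2 ≤ t y)
    (hT : ∑ y, t y ≤ T) :
    Real.exp (-((∑ y, r y) / (γ - rmax) + T / 2)) *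
        ∏ p, ∫ z, G p z ∂((gaussianFieldOfKernel (Kb p)).map
          fun (ζ : B1Eq324BenfattoLemma.Site d → ℝ) (x : B1Eq324BenfattoLemma.Site d) => condMean K Γ ξ x + ζ x) ≤
      ∫ z, ∏ p, G p z ∂((gaussianFieldOfKernel (condCov K Γ)).map
        fun (ζ : B1Eq324BenfattoLemma.Site d → ℝ) (x : B1Eq324BenfattoLemma.Site d) => condMean K Γ ξ x + ζ x) ∧
    ∫ z, ∏ p, G p z ∂((gaussianFieldOfKernel (condCov K Γ)).map
        fun (ζ : B1Eq324BenfattoLemma.Site d → ℝ) (x : B1Eq324BenfattoLemma.Site d) => condMean K Γ ξ x + ζ x) ≤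
      Real.exp ((∑ y, r y) / (γ - rmax) + T / 2) *
        ∏ p, ∫ z, G p z ∂((gaussianFieldOfKernel (Kb p)).map
          fun (ζ : B1Eq324BenfattoLemma.Site d → ℝ) (x : B1Eq324BenfattoLemma.Site d) => condMean K Γ ξ x + ζ x) := by
  classical
  have hA : A.PosDef := posDef_of_coercive hAs hγ0 hγ
  have hKpsd : IsPosSemidefKernel K := isPosSemidefKernel_kernel hK hA
  have hdetΓ : IsUnit (covGram K Γ).det := isUnit_det_covGram_kernel hK hA hΓ
  have hKc : IsPosSemidefKernel (condCov K Γ) := isPosSemidefKernel_condCov K hKpsd Γ hdetΓ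
  -- the measures
  set Pbar := (gaussianFieldOfKernel (condCov K Γ)).map
    fun (ζ : B1Eq324BenfattoLemma.Site d → ℝ) (x : B1Eq324BenfattoLemma.Site d) => condMean K Γ ξ x + ζ x with hPbar
  set N : σ → Measure (B1Eq324BenfattoLemma.Site d → ℝ) := fun p => (gaussianFieldOfKernel (Kb p)).map
    fun (ζ : B1Eq324BenfattoLemma.Site d → ℝ) (x : B1Eq324BenfattoLemma.Site d) => condMean K Γ ξ x + ζ x with hN
  haveI : IsProbabilityMeasure Pbar := isProbabilityMeasure_condFieldK hKpsd Γ hdetΓ ξ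
  have hPDp : ∀ p, (A.submatrix (fun j : ↥(box p) => (⟨j, (Finset.mem_sdiff.mp (hboxsub p j.2)).1⟩ : Λ))
      (fun j : ↥(box p) => (⟨j, (Finset.mem_sdiff.mp (hboxsub p j.2)).1⟩ : Λ))).PosDef := fun p =>
    hA.submatrix fun a b hab => Subtype.ext (by simpa using congrArg Subtype.val hab)
  have hKbpsd : ∀ p, IsPosSemidefKernel (Kb p) := fun p => isPosSemidefKernel_kernel (hKb p) (hPDp p)
  haveI hNprob : ∀ p, IsProbabilityMeasure (N p) := fun p => by
    haveI := isProbabilityMeasure_gaussianFieldOfKernel (hKbpsd p)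
    exact Measure.isProbabilityMeasure_map (measurable_shift _).aemeasurable
  -- gluing the datum `ξ` off the part
  set gl : (p : σ) → (↥(box p) → ℝ) → (B1Eq324BenfattoLemma.Site d → ℝ) :=
    fun p v x => if h : x ∈ box p then v ⟨x, h⟩ else ξ x with hgl
  have hglm : ∀ p, Measurable (gl p) := fun p => measurable_pi_lambda _ fun x => by
    by_cases h : x ∈ box p
    · simp only [hgl, dif_pos h]
      exact measurable_pi_apply _
    · simp only [hgl, dif_neg h]
      exact measurable_const
  have hglue : ∀ p (z : B1Eq324BenfattoLemma.Site d → ℝ), (∀ c ∈ Γ, z c = ξ c) → G p (gl p ((box p).restrict z)) = G p z := by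
    intro p z hz
    refine hGdep p _ _ fun x hx => ?_
    by_cases h : x ∈ box p
    · simp only [hgl, dif_pos h]
      rfl
    · simp only [hgl, dif_neg h]
      rcases hx with hx | hx
      · exact absurd hx h
      · exact (hz x hx).symm
  -- the `ℝ≥0∞`-valued box observables of J5-T
  set F : (p : σ) → (↥(box p) → ℝ) → ℝ≥0∞ := fun p v => ENNReal.ofReal (G p (gl p v)) with hF
  have hFm : ∀ p, Measurable (F p) := fun p => ENNReal.measurable_ofReal.comp ((hGm p).comp (hglm p))
  -- the support budget
  have hsupp : ∀ z : B1Eq324BenfattoLemma.Site d → ℝ, (∀ p, F p ((box p).restrict z) ≠ 0) →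
      ∑ y : ↥(Λ \ Γ), r y * (z y - condMean K Γ ξ y) ^ 2 ≤ T := by
    intro z hz
    refine le_trans (Finset.sum_le_sum fun y _ => ?_) hT
    have hyb : (y : B1Eq324BenfattoLemma.Site d) ∈ box (π y) := (hbox (π y) y).mpr rfl
    have hGne : G (π y) (gl (π y) ((box (π y)).restrict z)) ≠ 0 := fun h0 =>
      hz (π y) (by simp only [hF, h0, ENNReal.ofReal_zero])
    have h := hGt (π y) _ hGne y hyb
    have hgy : gl (π y) ((box (π y)).restrict z) y = z y := by
      simp only [hgl, dif_pos hyb]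
      rfl
    rwa [hgy] at h
  -- J5-T, both directions
  have hlow := exp_mul_prod_dirichlet_le_lintegral_prod_restrict_condFieldK hK hAs hγ0 hγ hΓ π r hr hrmax hγr ξ box hboxsub
    hbox hFm hsupp
  have hup := lintegral_prod_restrict_condFieldK_le_exp_mul_prod_dirichlet hK hAs hγ0 hγ hΓ π r hr hrmax hγr ξ box hboxsub
    hbox hFm hsupp
  -- the window law of the part fields
  have hwin : ∀ p, ∫⁻ y, F p (ofLp y) ∂multivariateGaussian (toLp 2 ((box p).restrict (condMean K Γ ξ)))
        (A.submatrix (fun j : ↥(box p) => (⟨j, (Finset.mem_sdiff.mp (hboxsub p j.2)).1⟩ : Λ))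
          (fun j : ↥(box p) => (⟨j, (Finset.mem_sdiff.mp (hboxsub p j.2)).1⟩ : Λ)))⁻¹ =
      ∫⁻ z, F p ((box p).restrict z) ∂(N p) := by
    intro p
    rw [hN, lintegral_comp_restrict_shift_eq (hKbpsd p) (condMean K Γ ξ) (box p) (hFm p), covGram_kernel_eq_inv (hKb p)]
  -- integrability of the bounded observables
  have hGi : ∀ p, Integrable (G p) (N p) := fun p =>
    Integrable.of_bound (hGm p).aestronglyMeasurable (M p) (ae_of_all _ fun z => by
      rw [Real.norm_eq_abs, abs_of_nonneg (hG0 p z)]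
      exact hGM p z)
  have hprod_m : Measurable fun z : B1Eq324BenfattoLemma.Site d → ℝ => ∏ p, G p z :=
    Finset.measurable_prod _ fun p _ => hGm p
  have hprod_0 : ∀ z : B1Eq324BenfattoLemma.Site d → ℝ, 0 ≤ ∏ p, G p z := fun z => Finset.prod_nonneg fun p _ => hG0 p z
  have hprod_i : Integrable (fun z : B1Eq324BenfattoLemma.Site d → ℝ => ∏ p, G p z) Pbar :=
    Integrable.of_bound hprod_m.aestronglyMeasurable (∏ p, M p) (ae_of_all _ fun z => by
      rw [Real.norm_eq_abs, abs_of_nonneg (hprod_0 z)]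
      exact Finset.prod_le_prod (fun p _ => hG0 p z) fun p _ => hGM p z)
  -- the part integrals, back in the Bochner currency (the `Γ`-values are `ξ`'s a.s.)
  have hpart : ∀ p, ∫⁻ z, F p ((box p).restrict z) ∂(N p) = ENNReal.ofReal (∫ z, G p z ∂(N p)) := by
    intro p
    rw [ofReal_integral_eq_lintegral_ofReal (hGi p) (ae_of_all _ (hG0 p))]
    refine lintegral_congr_ae ?_
    filter_upwards [partField_ae_eqOn hK hA hΓ (hboxsub p) (hKb p) ξ] with z hz
    simp only [hF, hglue p z hz]
  -- the conditioned side, back in the Bochner currency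
  have hPside : ∫⁻ z, ∏ p, F p ((box p).restrict z) ∂Pbar = ENNReal.ofReal (∫ z, ∏ p, G p z ∂Pbar) := by
    rw [ofReal_integral_eq_lintegral_ofReal hprod_i (ae_of_all _ hprod_0)]
    refine lintegral_congr_ae ?_
    filter_upwards [condFieldK_ae_eqOn hKpsd Γ hdetΓ ξ] with z hz
    rw [ENNReal.ofReal_prod_of_nonneg fun p _ => hG0 p z]
    exact Finset.prod_congr rfl fun p _ => by simp only [hF, hglue p z hz]
  have hI0 : ∀ p, 0 ≤ ∫ z, G p z ∂(N p) := fun p => integral_nonneg (hG0 p)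
  have hfac : ∏ p, ENNReal.ofReal (∫ z, G p z ∂(N p)) =
      ∏ p, ∫⁻ y, F p (ofLp y) ∂multivariateGaussian (toLp 2 ((box p).restrict (condMean K Γ ξ)))
        (A.submatrix (fun j : ↥(box p) => (⟨j, (Finset.mem_sdiff.mp (hboxsub p j.2)).1⟩ : Λ))
          (fun j : ↥(box p) => (⟨j, (Finset.mem_sdiff.mp (hboxsub p j.2)).1⟩ : Λ)))⁻¹ :=
    Finset.prod_congr rfl fun p _ => by rw [hwin p, hpart p]
  constructor
  · have h : ENNReal.ofReal (Real.exp (-((∑ y, r y) / (γ - rmax) + T / 2)) * ∏ p, ∫ z, G p z ∂(N p)) ≤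
        ENNReal.ofReal (∫ z, ∏ p, G p z ∂Pbar) := by
      rw [ENNReal.ofReal_mul (Real.exp_pos _).le, ENNReal.ofReal_prod_of_nonneg fun p _ => hI0 p, hfac, ← hPside]
      exact hlow
    exact (ENNReal.ofReal_le_ofReal_iff (integral_nonneg hprod_0)).mp h
  · have h : ENNReal.ofReal (∫ z, ∏ p, G p z ∂Pbar) ≤
        ENNReal.ofReal (Real.exp ((∑ y, r y) / (γ - rmax) + T / 2) * ∏ p, ∫ z, G p z ∂(N p)) := by
      rw [ENNReal.ofReal_mul (Real.exp_pos _).le, ENNReal.ofReal_prod_of_nonneg fun p _ => hI0 p, hfac, ← hPside]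
      exact hup
    exact (ENNReal.ofReal_le_ofReal_iff (mul_nonneg (Real.exp_pos _).le (Finset.prod_nonneg fun p _ => hI0 p))).mp h

/-- **THE CLASS (5.13) IN THE §5 CONSUMER'S CURRENCY, lower.**  Setting: the class kernel `K` of a symmetric `γ`-coercive precision `A` on
`Λ`; corridors `Γ ⊆ Λ`; a partition `π` of `↥(Λ ∖ Γ)` with parts `box p = {y : π y = p}` (as `Q₀`-windows); cross-row sums
`Σ_{π y′ ≠ π y}|A_{yy′}| ≤ r_y ≤ r_max < γ`, `ρ := (Σ_y r_y)/(γ − r_max)`; the PART FIELDS `N^K_{box p,ξ} = 𝒩(0,K_p)∘(u_Γ(ξ)+·)⁻¹` of the class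
kernels `K_p` of the sub-precisions `A|_{box p}` (rows `hKb`); REAL observables `0 ≤ G_p ≤ M_p` of the configuration, measurable, reading only
`box p ∪ Γ` (`hGdep`), with a per-site bounded-fluctuation budget `G_p(z) ≠ 0 → r_y(z_y − u_Γ(ξ)_y)² ≤ t_y` for `y ∈ box p` and `Σ_y t_y ≤ T`.  Then
`e^{−(ρ+T/2)}·Π_p ∫ G_p dN^K_{box p,ξ} ≤ ∫ Π_p G_p dP̄^K_{Γ,ξ}` — `…KernelComparisonBounded.exp_mul_prod_dirichlet_le_lintegral_prod_restrict_condFieldK`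
at `F_p := ofReal ∘ G_p ∘ (glue ξ off box p)`, the `Γ`-values being `ξ`'s almost surely under both measures (`…KernelCondField.condFieldK_ae_eqOn`,
`partField_ae_eqOn`), and the window law of the part fields (`…KernelComparison.lintegral_comp_restrict_shift_eq` +
`…KernelComparisonBoxes.covGram_kernel_eq_inv`).  The free-field statement replaced is `…Sect5Eq515.integral_P0_prefactor_mul_prod_eq₂`.
[cite: BenfattoEtAl1978, §5 (5.13) p.155, (5.15) p.155, p.153 «factorize “over the boxes □”» (class substitute at temperature zero; ours)] -/
theorem exp_mul_prod_integral_part_le_integral_prod_condFieldK {σ : Type*} [Fintype σ] [DecidableEq σ]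
    (hAs : ∀ e e', A e e' = A e' e) {γ rmax : ℝ} (hγ0 : 0 < γ)
    (hγ : ∀ x : Λ → ℝ, γ * ∑ e, x e ^ 2 ≤ ∑ e, ∑ e', A e e' * x e * x e')
    {Γ : Finset (B1Eq324BenfattoLemma.Site d)} (hΓ : Γ ⊆ Λ) (π : ↥(Λ \ Γ) → σ) (r : ↥(Λ \ Γ) → ℝ)
    (hr : ∀ y : ↥(Λ \ Γ), ∑ y' : ↥(Λ \ Γ), (if π y = π y' then (0 : ℝ) else
      |A ⟨y, (Finset.mem_sdiff.mp y.2).1⟩ ⟨y', (Finset.mem_sdiff.mp y'.2).1⟩|) ≤ r y)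
    (hrmax : ∀ y, r y ≤ rmax) (hγr : rmax < γ) (ξ : B1Eq324BenfattoLemma.Site d → ℝ)
    (box : σ → Finset (B1Eq324BenfattoLemma.Site d)) (hboxsub : ∀ p, box p ⊆ Λ \ Γ)
    (hbox : ∀ p (y : ↥(Λ \ Γ)), (y : B1Eq324BenfattoLemma.Site d) ∈ box p ↔ π y = p)
    {Kb : σ → B1Eq324BenfattoLemma.Site d → B1Eq324BenfattoLemma.Site d → ℝ}
    (hKb : ∀ p x y, Kb p x y = if h : x ∈ box p ∧ y ∈ box p then
      ((A.submatrix (fun j : ↥(box p) => (⟨j, (Finset.mem_sdiff.mp (hboxsub p j.2)).1⟩ : Λ))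
        (fun j : ↥(box p) => (⟨j, (Finset.mem_sdiff.mp (hboxsub p j.2)).1⟩ : Λ)))⁻¹ : Matrix ↥(box p) ↥(box p) ℝ)
          ⟨x, h.1⟩ ⟨y, h.2⟩ else 0)
    {G : σ → (B1Eq324BenfattoLemma.Site d → ℝ) → ℝ} (hGm : ∀ p, Measurable (G p)) (hG0 : ∀ p z, 0 ≤ G p z) {M : σ → ℝ}
    (hGM : ∀ p z, G p z ≤ M p)
    (hGdep : ∀ p (z z' : B1Eq324BenfattoLemma.Site d → ℝ), (∀ x, x ∈ box p ∨ x ∈ Γ → z x = z' x) → G p z = G p z')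
    {t : ↥(Λ \ Γ) → ℝ} {T : ℝ}
    (hGt : ∀ p (z : B1Eq324BenfattoLemma.Site d → ℝ), G p z ≠ 0 → ∀ y : ↥(Λ \ Γ), (y : B1Eq324BenfattoLemma.Site d) ∈ box p →
      r y * (z y - condMean K Γ ξ y) ^ 2 ≤ t y)
    (hT : ∑ y, t y ≤ T) :
    Real.exp (-((∑ y, r y) / (γ - rmax) + T / 2)) *
        ∏ p, ∫ z, G p z ∂((gaussianFieldOfKernel (Kb p)).map
          fun (ζ : B1Eq324BenfattoLemma.Site d → ℝ) (x : B1Eq324BenfattoLemma.Site d) => condMean K Γ ξ x + ζ x) ≤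
      ∫ z, ∏ p, G p z ∂((gaussianFieldOfKernel (condCov K Γ)).map
        fun (ζ : B1Eq324BenfattoLemma.Site d → ℝ) (x : B1Eq324BenfattoLemma.Site d) => condMean K Γ ξ x + ζ x) :=
  (core_two_sided hK hAs hγ0 hγ hΓ π r hr hrmax hγr ξ box hboxsub hbox hKb hGm hG0 hGM hGdep hGt hT).1

/-- **THE CLASS (5.13) IN THE §5 CONSUMER'S CURRENCY, upper**: with the same data,
`∫ Π_p G_p dP̄^K_{Γ,ξ} ≤ e^{ρ+T/2}·Π_p ∫ G_p dN^K_{box p,ξ}` (`…KernelComparisonBounded.lintegral_prod_restrict_condFieldK_le_exp_mul_prod_dirichlet`).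
The free-field statement replaced is `…Sect5Eq515.integral_P0_prefactor_mul_prod_eq₂` read at (5.36).
[cite: BenfattoEtAl1978, §5 (5.13) p.155, (5.36) p.159 (class substitute at temperature zero; ours)] -/
theorem integral_prod_condFieldK_le_exp_mul_prod_integral_part {σ : Type*} [Fintype σ] [DecidableEq σ]
    (hAs : ∀ e e', A e e' = A e' e) {γ rmax : ℝ} (hγ0 : 0 < γ)
    (hγ : ∀ x : Λ → ℝ, γ * ∑ e, x e ^ 2 ≤ ∑ e, ∑ e', A e e' * x e * x e')
    {Γ : Finset (B1Eq324BenfattoLemma.Site d)} (hΓ : Γ ⊆ Λ) (π : ↥(Λ \ Γ) → σ) (r : ↥(Λ \ Γ) → ℝ)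
    (hr : ∀ y : ↥(Λ \ Γ), ∑ y' : ↥(Λ \ Γ), (if π y = π y' then (0 : ℝ) else
      |A ⟨y, (Finset.mem_sdiff.mp y.2).1⟩ ⟨y', (Finset.mem_sdiff.mp y'.2).1⟩|) ≤ r y)
    (hrmax : ∀ y, r y ≤ rmax) (hγr : rmax < γ) (ξ : B1Eq324BenfattoLemma.Site d → ℝ)
    (box : σ → Finset (B1Eq324BenfattoLemma.Site d)) (hboxsub : ∀ p, box p ⊆ Λ \ Γ)
    (hbox : ∀ p (y : ↥(Λ \ Γ)), (y : B1Eq324BenfattoLemma.Site d) ∈ box p ↔ π y = p)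
    {Kb : σ → B1Eq324BenfattoLemma.Site d → B1Eq324BenfattoLemma.Site d → ℝ}
    (hKb : ∀ p x y, Kb p x y = if h : x ∈ box p ∧ y ∈ box p then
      ((A.submatrix (fun j : ↥(box p) => (⟨j, (Finset.mem_sdiff.mp (hboxsub p j.2)).1⟩ : Λ))
        (fun j : ↥(box p) => (⟨j, (Finset.mem_sdiff.mp (hboxsub p j.2)).1⟩ : Λ)))⁻¹ : Matrix ↥(box p) ↥(box p) ℝ)
          ⟨x, h.1⟩ ⟨y, h.2⟩ else 0)
    {G : σ → (B1Eq324BenfattoLemma.Site d → ℝ) → ℝ} (hGm : ∀ p, Measurable (G p)) (hG0 : ∀ p z, 0 ≤ G p z) {M : σ → ℝ}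
    (hGM : ∀ p z, G p z ≤ M p)
    (hGdep : ∀ p (z z' : B1Eq324BenfattoLemma.Site d → ℝ), (∀ x, x ∈ box p ∨ x ∈ Γ → z x = z' x) → G p z = G p z')
    {t : ↥(Λ \ Γ) → ℝ} {T : ℝ}
    (hGt : ∀ p (z : B1Eq324BenfattoLemma.Site d → ℝ), G p z ≠ 0 → ∀ y : ↥(Λ \ Γ), (y : B1Eq324BenfattoLemma.Site d) ∈ box p →
      r y * (z y - condMean K Γ ξ y) ^ 2 ≤ t y)
    (hT : ∑ y, t y ≤ T) :
    ∫ z, ∏ p, G p z ∂((gaussianFieldOfKernel (condCov K Γ)).map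
        fun (ζ : B1Eq324BenfattoLemma.Site d → ℝ) (x : B1Eq324BenfattoLemma.Site d) => condMean K Γ ξ x + ζ x) ≤
      Real.exp ((∑ y, r y) / (γ - rmax) + T / 2) *
        ∏ p, ∫ z, G p z ∂((gaussianFieldOfKernel (Kb p)).map
          fun (ζ : B1Eq324BenfattoLemma.Site d → ℝ) (x : B1Eq324BenfattoLemma.Site d) => condMean K Γ ξ x + ζ x) :=
  (core_two_sided hK hAs hγ0 hγ hΓ π r hr hrmax hγr ξ box hboxsub hbox hKb hGm hG0 hGM hGdep hGt hT).2

end Core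

end Literature.MathematicalPhysics.QuantumFieldTheory.Balaban1983to89.B1Eq324BenfattoKernelSect5Eq513

end
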